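import Mathlib
import HarnessLib

/-!
# Cesàro upgrade, helper 4: the Donsker–Varadhan inequalities and entropy bounds for weak limits

Support file for item `stmt-AtomisticToContinuum-13981` (`ParityLiouvilleSeed.CesaroUpgrade`).

Pure measure theory for probability measures `μ`, `ρ` on a measurable space `X`, relative
entropy `H(μ | ρ) = InformationTheory.klDiv μ ρ`:

* `integral_sub_log_integral_exp_le_klDiv` — the ENTROPY INEQUALITY (easy half of the
  Donsker–Varadhan variational formula): `∫ φ dμ - log ∫ e^φ dρ ≤ H(μ | ρ)` for bounded
  measurable `φ` (Gibbs' inequality for the tilted measure `e^φ ρ / ∫ e^φ dρ`, as in the tree's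
  `Literature.Probability.Entropy.KipnisLandim1999_A1_8_2_holds`);
* `integral_sub_log_integral_exp_le_of_forall_boundedContinuous` — first step of the HARD
  HALF on a pseudo-metrizable Borel space: the Donsker–Varadhan inequalities for bounded
  continuous test functions extend to bounded measurable ones (bounded continuous functions are
  dense in `L¹(μ + ρ)`; clamp the approximant). The sequel
  `ParityLiouvilleSeedCesaroUpgradeEntropyLimit` finishes the hard half (`μ ≪ ρ`, Fatou) and
  passes entropy bounds to weak limits.

No definitions.
-/

noncomputable section

namespace Summit.AtomisticToContinuum.FouriersLaw.Theorems.CesaroUpgrade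

open MeasureTheory Filter Topology Set BoundedContinuousFunction InformationTheory
open scoped ENNReal

variable {X : Type*} [MeasurableSpace X]

/-! ### The entropy inequality (easy half) -/

/-- **Entropy inequality** `∫ φ dμ - log ∫ e^φ dρ ≤ H(μ | ρ)` for bounded measurable `φ` and
probability measures with `H(μ | ρ) < ∞`. [folklore] -/
theorem integral_sub_log_integral_exp_le_klDiv {μ ρ : Measure X} [IsProbabilityMeasure μ]
    [IsProbabilityMeasure ρ] {φ : X → ℝ} (hφm : Measurable φ) {M : ℝ} (hφb : ∀ x, |φ x| ≤ M)
    (hkl : klDiv μ ρ ≠ ⊤) :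
    ∫ x, φ x ∂μ - Real.log (∫ x, Real.exp (φ x) ∂ρ) ≤ (klDiv μ ρ).toReal := by
  obtain ⟨hμρ, h_int⟩ := klDiv_ne_top_iff.mp hkl
  have hφμ : Integrable φ μ := Integrable.of_bound hφm.aestronglyMeasurable M
    (Eventually.of_forall fun x => by rw [Real.norm_eq_abs]; exact hφb x)
  have hexp : Integrable (fun x => Real.exp (φ x)) ρ := by
    refine Integrable.of_bound (hφm.exp).aestronglyMeasurable (Real.exp M)
      (Eventually.of_forall fun x => ?_)
    rw [Real.norm_eq_abs, abs_of_pos (Real.exp_pos _)]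
    exact Real.exp_le_exp.mpr ((le_abs_self _).trans (hφb x))
  haveI : IsProbabilityMeasure (ρ.tilted φ) := isProbabilityMeasure_tilted hexp
  have hμt : μ ≪ ρ.tilted φ := hμρ.trans (absolutelyContinuous_tilted hexp)
  have h_nonneg : 0 ≤ ∫ x, llr μ (ρ.tilted φ) x ∂μ := by
    rw [← toReal_klDiv_of_measure_eq hμt (by simp)]
    exact ENNReal.toReal_nonneg
  rw [integral_llr_tilted_right hμρ hφμ hexp h_int, ← toReal_klDiv_of_measure_eq hμρ (by simp)]
    at h_nonneg
  linarith

/-- The entropy inequality for a measure in a sublevel set `H(μ | ρ) ≤ C`, `C < ∞`, tested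
against a bounded continuous function. [folklore] -/
theorem integral_boundedContinuous_sub_log_le [TopologicalSpace X] [OpensMeasurableSpace X]
    {μ ρ : Measure X} [IsProbabilityMeasure μ] [IsProbabilityMeasure ρ] {C : ℝ≥0∞} (hC : C ≠ ⊤)
    (hkl : klDiv μ ρ ≤ C) (φ : X →ᵇ ℝ) :
    ∫ x, φ x ∂μ - Real.log (∫ x, Real.exp (φ x) ∂ρ) ≤ C.toReal := by
  have hM : ∀ x, |φ x| ≤ ‖φ‖ := fun x => by rw [← Real.norm_eq_abs]; exact φ.norm_coe_le_norm x
  exact (integral_sub_log_integral_exp_le_klDiv φ.continuous.measurable hM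
    (ne_top_of_le_ne_top hC hkl)).trans (ENNReal.toReal_mono hC hkl)

/-! ### The hard half: from bounded continuous to bounded measurable test functions -/

/-- `|e^a - e^b| ≤ e^M |a - b|` for `a, b ∈ [-M, M]` (convexity of `exp`). [folklore] -/
theorem abs_exp_sub_exp_le {a b M : ℝ} (ha : |a| ≤ M) (hb : |b| ≤ M) :
    |Real.exp a - Real.exp b| ≤ Real.exp M * |a - b| := by
  have key : ∀ u v : ℝ, |u| ≤ M → Real.exp u - Real.exp v ≤ Real.exp M * |u - v| := by
    intro u v hu
    have h1 : v - u + 1 ≤ Real.exp (v - u) := Real.add_one_le_exp _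
    have h2 : Real.exp u * (v - u + 1) ≤ Real.exp v := by
      calc Real.exp u * (v - u + 1) ≤ Real.exp u * Real.exp (v - u) :=
            mul_le_mul_of_nonneg_left h1 (Real.exp_pos u).le
        _ = Real.exp v := by rw [← Real.exp_add]; ring_nf
    have h3 : Real.exp u - Real.exp v ≤ Real.exp u * (u - v) := by nlinarith
    have h4 : Real.exp u ≤ Real.exp M := Real.exp_le_exp.mpr ((le_abs_self u).trans hu)
    calc Real.exp u - Real.exp v ≤ Real.exp u * (u - v) := h3
      _ ≤ Real.exp u * |u - v| := mul_le_mul_of_nonneg_left (le_abs_self _) (Real.exp_pos u).le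
      _ ≤ Real.exp M * |u - v| := mul_le_mul_of_nonneg_right h4 (abs_nonneg _)
  rw [abs_le]
  constructor
  · have := key b a hb
    rw [abs_sub_comm] at this
    linarith
  · exact key a b ha

/-- **Extension to bounded measurable test functions** (pseudo-metrizable Borel space): if
`∫ φ dμ - log ∫ e^φ dρ ≤ r` for all bounded continuous `φ`, the same holds for all bounded
measurable `ψ` (density of `C_b` in `L¹(μ + ρ)`, clamping the approximant). [folklore] -/
theorem integral_sub_log_integral_exp_le_of_forall_boundedContinuous [TopologicalSpace X]
    [TopologicalSpace.PseudoMetrizableSpace X] [BorelSpace X] {μ ρ : Measure X}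
    [IsProbabilityMeasure μ] [IsProbabilityMeasure ρ] {r : ℝ}
    (h : ∀ φ : X →ᵇ ℝ, ∫ x, φ x ∂μ - Real.log (∫ x, Real.exp (φ x) ∂ρ) ≤ r)
    {ψ : X → ℝ} (hψm : Measurable ψ) {M : ℝ} (hψb : ∀ x, |ψ x| ≤ M) :
    ∫ x, ψ x ∂μ - Real.log (∫ x, Real.exp (ψ x) ∂ρ) ≤ r := by
  have hbint : ∀ (ν : Measure X), IsFiniteMeasure ν → Integrable ψ ν := fun ν _ =>
    Integrable.of_bound hψm.aestronglyMeasurable M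
      (Eventually.of_forall fun x => by rw [Real.norm_eq_abs]; exact hψb x)
  have hexpb : ∀ (θ : X → ℝ), (∀ x, |θ x| ≤ M) → ∀ x, ‖Real.exp (θ x)‖ ≤ Real.exp M :=
    fun θ hθ x => by
      rw [Real.norm_eq_abs, abs_of_pos (Real.exp_pos _)]
      exact Real.exp_le_exp.mpr ((le_abs_self _).trans (hθ x))
  have hexpint : ∀ (θ : X → ℝ), Measurable θ → (∀ x, |θ x| ≤ M) →
      Integrable (fun x => Real.exp (θ x)) ρ := fun θ hθm hθ =>
    Integrable.of_bound hθm.exp.aestronglyMeasurable _ (Eventually.of_forall (hexpb θ hθ))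
  have hexp_pos : ∀ (θ : X → ℝ), Measurable θ → (∀ x, |θ x| ≤ M) →
      0 < ∫ x, Real.exp (θ x) ∂ρ := fun θ hθm hθ => by
    have : Real.exp (-M) ≤ ∫ x, Real.exp (θ x) ∂ρ := by
      calc Real.exp (-M) = ∫ _x, Real.exp (-M) ∂ρ := by simp
        _ ≤ ∫ x, Real.exp (θ x) ∂ρ :=
          integral_mono (integrable_const _) (hexpint θ hθm hθ) fun x =>
            Real.exp_le_exp.mpr (neg_le_of_abs_le (hθ x))
    exact lt_of_lt_of_le (Real.exp_pos _) this
  have hI := hexp_pos ψ hψm hψb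
  -- it suffices to prove the inequality up to an arbitrary `δ > 0`
  suffices key : ∀ δ : ℝ, 0 < δ → ∫ x, ψ x ∂μ - δ -
      Real.log ((∫ x, Real.exp (ψ x) ∂ρ) + Real.exp M * δ) ≤ r by
    have hcont : Tendsto (fun δ : ℝ => ∫ x, ψ x ∂μ - δ -
        Real.log ((∫ x, Real.exp (ψ x) ∂ρ) + Real.exp M * δ)) (𝓝[>] 0)
        (𝓝 (∫ x, ψ x ∂μ - 0 - Real.log ((∫ x, Real.exp (ψ x) ∂ρ) + Real.exp M * 0))) := by
      refine Tendsto.mono_left ?_ nhdsWithin_le_nhds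
      have h2 : Tendsto (fun δ : ℝ => (∫ x, Real.exp (ψ x) ∂ρ) + Real.exp M * δ) (𝓝 0)
          (𝓝 ((∫ x, Real.exp (ψ x) ∂ρ) + Real.exp M * 0)) :=
        tendsto_const_nhds.add (tendsto_const_nhds.mul tendsto_id)
      have h3 := (Real.continuousAt_log (by rw [mul_zero, add_zero]; exact hI.ne')).tendsto.comp h2
      exact (tendsto_const_nhds.sub tendsto_id).sub h3
    simp only [mul_zero, add_zero, sub_zero] at hcont
    exact le_of_tendsto hcont (eventually_nhdsWithin_of_forall fun δ hδ => key δ hδ)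
  intro δ hδ
  -- density of bounded continuous functions in `L¹(μ + ρ)`, then clamp to `[-M, M]`
  obtain ⟨g, hg, -⟩ := (hbint (μ + ρ) inferInstance).exists_boundedContinuous_integral_sub_le hδ
  have hLip : LipschitzWith 1 (fun t : ℝ => max (-M) (min t M)) :=
    (LipschitzWith.id.min_const M).const_max (-M)
  set φ : X →ᵇ ℝ := BoundedContinuousFunction.comp _ hLip g with hφdef
  have hφ_apply : ∀ x, φ x = max (-M) (min (g x) M) := fun x => rfl
  have hM0 : 0 ≤ M := by
    have hne : Nonempty X := by
      by_contra hX
      have : (μ : Measure X) univ = 0 := by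
        rw [univ_eq_empty_iff.mpr (not_nonempty_iff.mp hX), measure_empty]
      exact zero_ne_one (this.symm.trans measure_univ)
    exact (abs_nonneg _).trans (hψb (Classical.arbitrary X))
  have hφb : ∀ x, |φ x| ≤ M := fun x => by
    rw [hφ_apply, abs_le]
    exact ⟨le_max_left _ _, max_le (by linarith) (min_le_right _ _)⟩
  have hptw : ∀ x, |ψ x - φ x| ≤ |ψ x - g x| := fun x => by
    have hfix : max (-M) (min (ψ x) M) = ψ x := by
      obtain ⟨h1, h2⟩ := abs_le.mp (hψb x)
      rw [min_eq_left h2, max_eq_right h1]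
    rw [hφ_apply, ← Real.dist_eq, ← Real.dist_eq]
    have := hLip.dist_le_mul (ψ x) (g x)
    rw [hfix, NNReal.coe_one, one_mul] at this
    exact this
  have hdiff_int : ∀ (ν : Measure X), IsFiniteMeasure ν → Integrable (fun x => ψ x - φ x) ν :=
    fun ν hν => (hbint ν hν).sub (φ.integrable ν)
  have hL1 : ∀ (ν : Measure X), IsFiniteMeasure ν → ν ≤ μ + ρ → ∫ x, |ψ x - φ x| ∂ν ≤ δ := by
    intro ν hν hle
    calc ∫ x, |ψ x - φ x| ∂ν ≤ ∫ x, |ψ x - φ x| ∂(μ + ρ) :=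
          integral_mono_measure hle (Eventually.of_forall fun x => abs_nonneg _)
            (hdiff_int _ inferInstance).abs
      _ ≤ ∫ x, ‖ψ x - g x‖ ∂(μ + ρ) :=
          integral_mono (hdiff_int _ inferInstance).abs
            ((hbint _ inferInstance).sub (g.integrable _)).norm fun x => by
            rw [Real.norm_eq_abs]; exact hptw x
      _ ≤ δ := hg
  have hμle := hL1 μ inferInstance (Measure.le_add_right le_rfl)
  have hρle := hL1 ρ inferInstance (Measure.le_add_left le_rfl)
  -- the two integrals move by at most `δ` and `e^M δ`
  have hA : ∫ x, ψ x ∂μ - δ ≤ ∫ x, φ x ∂μ := by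
    have : |∫ x, ψ x ∂μ - ∫ x, φ x ∂μ| ≤ δ := by
      rw [← integral_sub (hbint μ inferInstance) (φ.integrable _)]
      exact abs_integral_le_integral_abs.trans hμle
    linarith [(abs_le.mp this).2]
  have hB : ∫ x, Real.exp (φ x) ∂ρ ≤ (∫ x, Real.exp (ψ x) ∂ρ) + Real.exp M * δ := by
    have hφm : Measurable (φ : X → ℝ) := φ.continuous.measurable
    have : |∫ x, Real.exp (φ x) ∂ρ - ∫ x, Real.exp (ψ x) ∂ρ| ≤ Real.exp M * δ := by
      rw [← integral_sub (hexpint _ hφm hφb) (hexpint ψ hψm hψb)]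
      refine abs_integral_le_integral_abs.trans ?_
      calc ∫ x, |Real.exp (φ x) - Real.exp (ψ x)| ∂ρ ≤ ∫ x, Real.exp M * |ψ x - φ x| ∂ρ := by
            refine integral_mono ((hexpint _ hφm hφb).sub (hexpint ψ hψm hψb)).abs
              ((hdiff_int ρ inferInstance).abs.const_mul _) fun x => ?_
            rw [abs_sub_comm (ψ x)]
            exact abs_exp_sub_exp_le (hφb x) (hψb x)
        _ = Real.exp M * ∫ x, |ψ x - φ x| ∂ρ := integral_const_mul _ _
        _ ≤ Real.exp M * δ := mul_le_mul_of_nonneg_left hρle (Real.exp_pos M).le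
    linarith [(abs_le.mp this).2]
  have hlog : Real.log (∫ x, Real.exp (φ x) ∂ρ) ≤
      Real.log ((∫ x, Real.exp (ψ x) ∂ρ) + Real.exp M * δ) :=
    Real.log_le_log (hexp_pos _ φ.continuous.measurable hφb) hB
  linarith [h φ]


end Summit.AtomisticToContinuum.FouriersLaw.Theorems.CesaroUpgrade

end
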